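import Literature.Computability.Cryptography.CryptoFoundationsOneWayFunctions
import Literature.Computability.Cryptography.OneWayFunctionsProofs
import Literature.Computability.Complexity.SearchToDecision
import Literature.Computability.Complexity.SearchToDecisionBPP
import Literature.Computability.Complexity.RandomizedProofs
import HarnessLib

/-!
# One-way functions imply `P ≠ NP` (proofs)

Sibling proof file of `CryptoFoundationsOneWayFunctions.lean` (D-0014: named facts
`def X : Prop` are discharged as `theorem X_holds : X`). It discharges

* `Literature.CryptoFoundations.P_ne_NP_of_OWFExist_holds : P_ne_NP_of_OWFExist` — if (strong)
  one-way functions exist then `P ≠ NP` (**crypto-foundations.S12**, corollary form).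
* `Literature.Computability.Cryptography.OWFExist_of_nonuniform_holds : OWFExist_of_nonuniform`
  and `oneWayFunctionsExist_of_nonuniformOWFHypothesis_holds` — if one-way functions secure
  against non-uniform polynomial-time adversaries exist, then (uniformly secure) one-way
  functions exist (**crypto-foundations.S22**, `S_nu ⇒ S`): Goldreich 2001, §2.2.5,
  **Proposition 2.2.7**, lifted to the existence flags from the tree's discharge
  `IsOneWayNonuniform.isOneWay_holds` (`OneWayFunctionsProofs.lean`); see the last section.

This is Goldreich, *Foundations of Cryptography I* (2001), §2.7.4, **Exercise 2** ("One-way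
functions and the P-versus-NP question (Part 1): Prove that the existence of one-way functions
implies `P ≠ NP`"), with its printed **guideline**: "For any polynomial-time-computable function
`f`, define a set `L_f ∈ NP` such that if `L_f ∈ P`, then there exists a polynomial-time
algorithm for inverting `f`"; cf. the remarks of §2.1 and of §1.3.4 ("Intractability
Assumptions": the computational approach "is interesting only if `NP` is not contained in `BPP`
(which certainly implies `P ≠ NP`)").

## The printed proof and its rendering here

* **The set `L_f` and search from decision** (`SearchToDecision.lean`). The solution relation
  `invRel f = {⟨⟨u, y⟩, x'⟩ | |x'| = |u| ∧ f x' = y}` (`boolPair`-coded; the inverter's input is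
  Goldreich's auxiliary-input form `⟨1ⁿ, f x⟩ = boolPair (unaryEncodeNat n) (f x)` of
  `invertProb`, Def. 2.2.1) is in `P` for `f ∈ FP` (`invRel_mem_P`); Goldreich's `NP`-set `L_f`
  of extendable partial preimages is `SuffExt (invRel f) X` (`SuffExt_mem_NP`), and every
  instance `⟨1ⁿ, f x⟩` with `|x| = n` has the solution `x`. If `P = NP` then, by Arora–Barak's
  Thm. 2.18 in the form `exists_searchFn_of_NP_subset_P`, some `g ∈ FP` returns a solution on
  every solvable instance: `f (g ⟨1ⁿ, f x⟩) = f x` for all `x` (`exists_inverter_of_NP_subset_P`).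
* **The inverter.** The coin-free algorithm `RandAlg.ofDet g` is PPT
  (`RandAlg.IsPolyTime.ofDet_holds`, `RandomizedProofs.lean`) and inverts with probability `1`
  on every `x` (`RandAlg.pr_ofDet`), so `invertProb f (ofDet g) n = 1` for all `n`
  (`invertProb_ofDet_eq_one`), which is not negligible (`SuperpolynomialDecay` at exponent `0`
  would force `1 → 0`). Hence no `f` is one-way if `NP ⊆ P` (`not_isOneWay_of_NP_subset_P`), i.e.
  `OWFExist → ¬ (NP ⊆ P)` (`NP_not_subset_P_of_OWFExist`) and `OWFExist → P ≠ NP`.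

## References

* O. Goldreich, *Foundations of Cryptography I: Basic Tools*, Cambridge University Press 2001
  (online edn. 2004, doi:10.1017/CBO9780511721656), §2.7.4, Exercise 2 (and guideline); §2.1;
  §1.3.4; Def. 2.2.1; §2.2.5, Def. 2.2.6 and Prop. 2.2.7 (non-uniformly one-way ⇒ one-way).
* S. Arora, B. Barak, *Computational Complexity: A Modern Approach*, CUP 2009, Thm. 2.18
  (decision versus search), §9.2 (one-way functions; "assuming `P ≠ NP` will be necessary").
-/

namespace Literature.Computability.Cryptography

open Filter Asymptotics _root_.Computability Complexity Complexity.Classes Complexity.Nondeterministic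

/-! ### The inverter and its success probability -/

/-- **A sure inverter has inversion probability `1`**: if `g` inverts `f` on every `⟨1ⁿ, f x⟩`
with `|x| = n`, then `invertProb f (RandAlg.ofDet g) n = 1` (the coin-free algorithm's success
event has probability `1` on every `x`, `RandAlg.pr_ofDet`, and the uniform average of the
constant `1` is `1`). [Goldreich 2001, Def. 2.2.1] [cite: Goldreich2001, Def. 2.2.1] -/
theorem invertProb_ofDet_eq_one {f g : List Bool → List Bool}
    (hg : ∀ (n : ℕ) (x : List Bool), x.length = n → f (g (boolPair (unaryEncodeNat n) (f x))) = f x)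
    (n : ℕ) : invertProb f (RandAlg.ofDet g) n = 1 := by
  classical
  unfold invertProb uniformAvg
  have h1 : ∀ x : List.Vector Bool n,
      (RandAlg.ofDet g).pr id (boolPair (unaryEncodeNat n) (f x.toList)) {z | f z = f x.toList} = 1 := by
    intro x
    rw [RandAlg.pr_ofDet, if_pos]
    exact hg n x.toList x.toList_length
  simp only [h1, Finset.sum_const, Finset.card_univ, card_vector, Fintype.card_bool, nsmul_eq_mul,
    mul_one]
  push_cast
  exact div_self (by positivity)

/-- **No function is one-way if `NP ⊆ P`.** [Goldreich 2001, §2.7.4, Exercise 2; §2.1]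
[cite: Goldreich2001, §2.7.4 Exercise 2] -/
theorem not_isOneWay_of_NP_subset_P (hNP : NP ⊆ P) (f : List Bool → List Bool) : ¬ IsOneWay f := by
  intro hf
  obtain ⟨g, hg, hinv⟩ := exists_inverter_of_NP_subset_P hNP hf.1
  have hdecay := hf.2 (RandAlg.ofDet g) (RandAlg.IsPolyTime.ofDet_holds hg)
  have h1 : invertProb f (RandAlg.ofDet g) = fun _ => (1 : ℝ) :=
    funext (invertProb_ofDet_eq_one fun n x hx => (hinv n x hx).2)
  rw [h1] at hdecay
  have h0 := hdecay 0
  simp only [pow_zero, one_mul] at h0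
  exact one_ne_zero (tendsto_nhds_unique tendsto_const_nhds h0)

/-- **One-way functions imply `NP ⊄ P`.** [Goldreich 2001, §2.7.4, Exercise 2; §2.1]
[cite: Goldreich2001, §2.7.4 Exercise 2] -/
theorem NP_not_subset_P_of_OWFExist (h : OWFExist) : ¬ (NP ⊆ P) :=
  fun hNP => h.elim fun f hf => not_isOneWay_of_NP_subset_P hNP f hf

/-- **Discharge of `P_ne_NP_of_OWFExist`** (crypto-foundations.S12, corollary form): if one-way
functions exist then `P ≠ NP`. Goldreich 2001, §2.7.4, Exercise 2: "Prove that the existence of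
one-way functions implies `P ≠ NP`" (guideline: the `NP`-set `L_f`; if `L_f ∈ P` then `f` has a
polynomial-time inverter). [cite: Goldreich2001, §2.7.4 Exercise 2] -/
theorem P_ne_NP_of_OWFExist_holds : P_ne_NP_of_OWFExist :=
  fun h hPNP => NP_not_subset_P_of_OWFExist h hPNP.symm.subset

/-! ### crypto-foundations.S22: non-uniformly secure OWF give OWF (`S_nu ⇒ S`)

Goldreich 2001, §2.2.5: Def. 2.2.6 (non-uniformly one-way: easy to compute by a uniform
polynomial-time algorithm, hard to invert "for every (even non-uniform) family of
polynomial-size circuits") and **Proposition 2.2.7**: "If `f` is non-uniformly one-way, then it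
is one-way. That is, if `f` satisfies Definition 2.2.6, then it also satisfies
Definition 2.2.1." The tree renders polynomial-size circuits as PPT adversaries with
polynomial-length advice (`IsOneWayNonuniform`, `OneWayFunctions.lean`), and Prop. 2.2.7 is
discharged as `IsOneWayNonuniform.isOneWay_holds` (`OneWayFunctionsProofs.lean`: a uniform PPT
inverter is the advised adversary with empty advice, same success probability). The existence
flags follow by keeping the same witness `f`. -/

/-- **Discharge of `OWFExist_of_nonuniform`** (crypto-foundations.S22, `S_nu ⇒ S`): if one-way
functions secure against non-uniform polynomial-time adversaries exist (`NonuniformOWFExist`),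
then (uniformly secure) one-way functions exist (`OWFExist`) — the same `f` is a witness, by
Goldreich 2001, Prop. 2.2.7 ("If `f` is non-uniformly one-way, then it is one-way"), i.e. the
tree theorem `IsOneWayNonuniform.isOneWay_holds`. [cite: Goldreich2001, §2.2.5 Prop. 2.2.7] -/
theorem OWFExist_of_nonuniform_holds : OWFExist_of_nonuniform :=
  fun ⟨f, hf⟩ => ⟨f, IsOneWayNonuniform.isOneWay_holds hf⟩

/-- **Discharge of `oneWayFunctionsExist_of_nonuniformOWFHypothesis`**: the same implication on
the two flags `NonuniformOWFHypothesis := NonuniformOWFExist` and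
`OneWayFunctionsExist := OWFExist` (both reducible to the prelude statements by `rfl`).
[cite: Goldreich2001, §2.2.5 Prop. 2.2.7] -/
theorem oneWayFunctionsExist_of_nonuniformOWFHypothesis_holds :
    oneWayFunctionsExist_of_nonuniformOWFHypothesis :=
  fun h => OWFExist_of_nonuniform_holds h

/-! ## One-way functions imply `NP ⊄ BPP` (crypto-foundations.S12, main form)

Discharge of `Literature.Computability.Cryptography.NP_not_subset_BPP_of_OWFExist` — "the
existence of one-way functions implies that `NP` is not contained in `BPP`, and thus would
establish that `NP ≠ P`" (Goldreich 2001, §1.5.3; §2.7.3: "`NP ∖ BPP ≠ ∅` is a necessary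
condition for the existence of one-way functions"; §2.1). The book prints no proof; the argument
is the guideline to §2.7.4, Exercise 2 (the `NP`-set `L_f`; here the relation `invRel f ∈ P` of
`SearchToDecision.lean`) read for probabilistic machines: by the randomized decision-to-search
theorem `exists_randSearch_two_thirds_of_NP_subset_BPP` (`SearchToDecisionBPP.lean`: bit-by-bit
search against an error-reduced `BPP`-decider of the extension language, §1.5.4 Exercise 4, and a
union bound over the rounds), `NP ⊆ BPP` yields a PPT algorithm that on `⟨1ⁿ, f x⟩`, `|x| = n`,
outputs a preimage of `f x` with probability `≥ 2/3` (`exists_pptInverter_of_NP_subset_BPP`); hence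
`invertProb f A n ≥ 2/3` for every `n` (`le_invertProb_of_forall_le`), which is not negligible, so
no polynomial-time `f` is one-way (`not_isOneWay_of_NP_subset_BPP`). -/

/-- **A PPT inverter from `NP ⊆ BPP`.** If `NP ⊆ BPP` and `f ∈ FP`, some probabilistic
polynomial-time `A` inverts `f` on every input `⟨1ⁿ, f x⟩`, `|x| = n`, with probability `≥ 2/3`:
`Pr[A(1ⁿ, f x) ∈ f⁻¹(f x)] ≥ 2/3` (randomized search for the relation `invRel f ∈ P` with solution
bound `X`; the instance `⟨1ⁿ, f x⟩` has the solution `x`, and every solution is a preimage).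
[Goldreich 2001, §2.7.4 Exercise 2 (guideline) with §1.5.4 Exercise 4; §2.7.3]
[cite: Goldreich2001, §2.7.3 and §2.7.4 Exercise 2] -/
theorem exists_pptInverter_of_NP_subset_BPP (hNP : NP ⊆ BPP) {f : List Bool → List Bool}
    (hf : f ∈ FP) :
    ∃ A : RandAlg (List Bool) (List Bool), IsPPT A id ∧
      ∀ (n : ℕ) (x : List Bool), x.length = n →
        2 / 3 ≤ A.pr id (boolPair (unaryEncodeNat n) (f x)) {z | f z = f x} := by
  obtain ⟨A, hA, -, h⟩ :=
    exists_randSearch_two_thirds_of_NP_subset_BPP hNP (invRel_mem_P hf) Polynomial.X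
  refine ⟨A, hA, fun n x hx => ?_⟩
  have hn : (unaryEncodeNat n).length = n := unary_decode_encode_nat n
  have hsol : ∃ y : List Bool, y.length ≤ (Polynomial.X : Polynomial ℕ).eval
      (boolPair (unaryEncodeNat n) (f x)).length ∧
        boolPair (boolPair (unaryEncodeNat n) (f x)) y ∈ invRel f := by
    refine ⟨x, ?_, (boolPair_mem_invRel f _ _ x).2 ⟨hx.trans hn.symm, rfl⟩⟩
    rw [Polynomial.eval_X, length_boolPair, hn, hx]
    omega
  refine (h _ hsol).trans ?_
  rw [RandAlg.pr_eq_uniformProb, RandAlg.pr_eq_uniformProb]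
  refine Complexity.PromiseCook.uniformProb_mono fun r hr => ?_
  simp only [Set.mem_setOf_eq] at hr ⊢
  exact ((boolPair_mem_invRel f _ _ _).1 hr.2).2

/-- **A pointwise success bound bounds the inversion probability**: if `A` inverts `f` on every
`⟨1ⁿ, f x⟩`, `|x| = n`, with probability `≥ c`, then `invertProb f A n ≥ c` (the uniform average of
terms `≥ c` is `≥ c`). [Goldreich 2001, Def. 2.2.1] [cite: Goldreich2001, Def. 2.2.1] -/
theorem le_invertProb_of_forall_le {f : List Bool → List Bool} {A : RandAlg (List Bool) (List Bool)}
    {n : ℕ} {c : ℝ}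
    (h : ∀ x : List Bool, x.length = n →
      c ≤ A.pr id (boolPair (unaryEncodeNat n) (f x)) {z | f z = f x}) :
    c ≤ invertProb f A n := by
  unfold invertProb uniformAvg
  rw [le_div_iff₀ (by positivity)]
  calc c * 2 ^ n = ∑ _x : List.Vector Bool n, c := by
        rw [Finset.sum_const, Finset.card_univ, card_vector, Fintype.card_bool, nsmul_eq_mul]
        push_cast
        ring
    _ ≤ ∑ x : List.Vector Bool n,
          A.pr id (boolPair (unaryEncodeNat n) (f x.toList)) {z | f z = f x.toList} :=
        Finset.sum_le_sum fun x _ => h x.toList x.toList_length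

/-- **No function is one-way if `NP ⊆ BPP`**: the PPT inverter of
`exists_pptInverter_of_NP_subset_BPP` has `invertProb f A n ≥ 2/3` for all `n`, whereas one-wayness
makes `invertProb f A` negligible, in particular eventually `< 2/3`.
[Goldreich 2001, §2.7.3; §1.5.3; §2.7.4 Exercise 2] [cite: Goldreich2001, §2.7.3 and §2.7.4 Exercise 2] -/
theorem not_isOneWay_of_NP_subset_BPP (hNP : NP ⊆ BPP) (f : List Bool → List Bool) :
    ¬ IsOneWay f := by
  intro hf
  obtain ⟨A, hA, hinv⟩ := exists_pptInverter_of_NP_subset_BPP hNP hf.1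
  have h23 : ∀ n, (2 / 3 : ℝ) ≤ invertProb f A n := fun n => le_invertProb_of_forall_le (hinv n)
  have h0 := (hf.2 A hA) 0
  simp only [pow_zero, one_mul] at h0
  have hev : ∀ᶠ n : ℕ in atTop, invertProb f A n < 2 / 3 :=
    h0.eventually (gt_mem_nhds (by norm_num))
  obtain ⟨n, hn⟩ := hev.exists
  exact absurd (h23 n) (not_le.2 hn)

/-- **Discharge of `NP_not_subset_BPP_of_OWFExist`** (crypto-foundations.S12): if one-way functions
exist then `NP ⊄ BPP` — "the existence of one-way functions implies that `NP` is not contained in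
`BPP`" (Goldreich 2001, §1.5.3), "`NP ∖ BPP ≠ ∅` is a necessary condition for the existence of
one-way functions" (§2.7.3, referring to §2.1). [cite: Goldreich2001, §2.7.3 and §1.5.3] -/
theorem NP_not_subset_BPP_of_OWFExist_holds : NP_not_subset_BPP_of_OWFExist :=
  fun h hNP => h.elim fun f hf => not_isOneWay_of_NP_subset_BPP hNP f hf

end Literature.Computability.Cryptography
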